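import Mathlib
import Summits.Ventures.HodgeRepro2.Tier7.Line3.UnramifiedFactor
import Summits.Ventures.HodgeRepro2.Tier7.Line3.ConcreteLevelFactor
import Summits.Ventures.HodgeRepro2.Tier7.Line3.AdicCompletionInvolution
import Summits.Ventures.HodgeRepro2.Tier7.Line3.LocalFactorClauses

/-!
# Tier7/Line3/UnramifiedPlaceCompletion — the unramified-place factor on the concrete tori and on Mathlib's completion
(seat t7-x1, gen 5; the `b`-side places `≠ v₁` of the unramified inert kind instantiated as the level place was)

LINE 3 (t7-plan-3), version (ii). UnramifiedFactor (p709130) proves the three per-place clauses at an unramified inert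
place for ABSTRACT tori `A, B` inside a subgroup `K` of `G`, trivial characters, finite left-invariant measures of
positive mass, and the dominant coset in the support. This module instantiates it as ConcreteLevelFactor (p698828) /
AdicCompletionLocalField (p703140) instantiated the level place:

* `integralSubgroupAbv abv hna : Subgroup (GL (Fin 2) F)` — `GL₂(𝓞)`: the matrices with entries and inverse entries of
  absolute value `≤ 1` (closed under products by the ultrametric `EntryLE.mul`);
* `iotaA_mem_integralSubgroupAbv`: the FIRST torus (diagonal, norm-one entries) lies in `GL₂(𝓞)` for every isometric
  involution — a THEOREM (`nrm σ x = 1` and `‖σ x‖ = ‖x‖` give `‖x‖ = 1`); the second torus' integrality is the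
  chain's displayed `hB / hB'` («`T_B ⊂ GL₂(𝓞)`», L1-p2 / plan-3 STATUS l. 15829 (a));
* `unramified_placeClauses`: on a proper ultrametric normed field `F` with a continuous isometric involution `σ` and
  the second basis `f` (matrix `P`), with the trivial characters, the three clauses of the unramified kind hold for
  Mathlib's Haar measures on the compact tori — stated as ConcreteLevelFactor states its assembly: the Borel
  σ-algebras and the Haar measures are DISPLAYED as conjuncts of an `∃`, and the clauses are
  `PlaceClauses (unramifiedFactor μA μB (iotaA σ) (iotaB σ f) 1 1 (integralSubgroupAbv normAbv _) loc)
  (fun γ => InSupport (iotaA σ) (iotaB σ f) 1 (integralSubgroupAbv …) (loc γ)) 1 0 size γ₀` (LocalFactorClauses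
  p717818), with ONLY `hB / hB'` and `hγ₀ : loc γ₀ ∈ ι_A(A) GL₂(𝓞) ι_B(B)` displayed;
* `unramified_placeClauses_adicCompletion`: the same at `F := w.adicCompletion E` with `σ := completionMap w σ hσ`
  (the instance binders and `hσc / hσn` discharged by p703140 / p703979).

WHAT THIS CHANGES IN THE [W] COLUMN: at the unramified inert places `≠ v₁`, «`A, B = T_A(E⁺_w), T_B(E⁺_w)` inside
`K_w = GL₂(𝓞_{E,w})`, `χA = ψB = 1`, the Haar measures» (UnramifiedFactor's dictionary) → the model's tori on Mathlib's
completion with Mathlib's Haar measures, `K_w` the integral subgroup, `T_A ⊂ K_w` a theorem; STILL IN WORDS: that the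
real `w` is unramified for the datum (the characters trivial — here `1`), `T_B ⊂ GL₂(𝓞)` (displayed), `loc γ` the
`w`-component with `loc γ₀ ∈ K_w` (displayed), the identification (a′). Nothing here is about (N), (P), the real `X`,
or HC_CM; §8(d): NO. Blind lane: Mathlib + the HodgeRepro2 prefix; no sorry; axioms ⊆ {propext, Classical.choice,
Quot.sound}.
-/

namespace Summit.Ventures.HodgeRepro2.Tier7.Line3.UnramifiedPlaceCompletion

open Matrix MeasureTheory NumberField IsDedekindDomain IsDedekindDomain.HeightOneSpectrum
  Summit.Ventures.HodgeRepro2.Tier7.Line3.CongruenceSubgroup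
  Summit.Ventures.HodgeRepro2.Tier7.Line3.LevelTowerTopology
  Summit.Ventures.HodgeRepro2.Tier7.Line3.LevelInvariantOrbital
  Summit.Ventures.HodgeRepro2.Tier7.Line3.TorusSupport
  Summit.Ventures.HodgeRepro2.Tier7.Line3.TorusCompact
  Summit.Ventures.HodgeRepro2.Tier7.Line3.ConcreteLevelFactor
  Summit.Ventures.HodgeRepro2.Tier7.Line3.UnramifiedFactor
  Summit.Ventures.HodgeRepro2.Tier7.Line3.LocalFactorClauses
  Summit.Ventures.HodgeRepro2.Tier7.Line3.AdicCompletionInvolution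
  Summit.Ventures.HodgeRepro2.T7SupportTwoTorusInvariant
open scoped NumberField

/-! ## The integral subgroup `GL₂(𝓞)` -/

section integral

variable {F : Type*} [Field F] (abv : AbsoluteValue F ℝ) (hna : IsNonarchimedean abv)

/-- **the integral subgroup** `GL₂(𝓞) = {g : entries of g and of g⁻¹ of absolute value ≤ 1}` — the ABSOLUTE-VALUE-side
twin of DoubleCosetCover's `integralSubgroup (O : Subring F)` (p714118, entries of `g` and `g⁻¹` in `O`), named apart
(crit-2 STATUS l. 16278 (B)(1)); at the model (`abv = normAbv`, `O` = the valuation ring) the two coincide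
(`‖x‖ ≤ 1 ↔ Valued.v x ≤ 1`, AdicCompletionLevel's normalisation at `N = 0` — a one-line bridge for a later row,
not this one). -/
def integralSubgroupAbv : Subgroup (GL (Fin 2) F) where
  carrier := {g | EntryLE abv 1 (g : Matrix (Fin 2) (Fin 2) F) ∧
    EntryLE abv 1 ((g⁻¹ : GL (Fin 2) F) : Matrix (Fin 2) (Fin 2) F)}
  mul_mem' := by
    intro g h hg hh
    refine ⟨?_, ?_⟩
    · have := EntryLE.mul abv hna zero_le_one hg.1 hh.1
      rwa [one_mul, ← Units.val_mul] at this
    · have := EntryLE.mul abv hna zero_le_one hh.2 hg.2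
      rwa [one_mul, ← Units.val_mul, ← _root_.mul_inv_rev] at this
  one_mem' := ⟨entryLE_one abv, by rw [inv_one]; exact entryLE_one abv⟩
  inv_mem' := by
    intro g hg
    exact ⟨hg.2, by rw [inv_inv]; exact hg.1⟩

/-- membership in the integral subgroup, by definition. -/
theorem mem_integralSubgroupAbv (g : GL (Fin 2) F) :
    g ∈ integralSubgroupAbv abv hna ↔ EntryLE abv 1 (g : Matrix (Fin 2) (Fin 2) F) ∧
      EntryLE abv 1 ((g⁻¹ : GL (Fin 2) F) : Matrix (Fin 2) (Fin 2) F) := Iff.rfl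

variable (σ : F →+* F)

/-- a norm-one element has absolute value one when the involution is isometric. -/
theorem abv_eq_one_of_nrm (hσ : ∀ x, abv (σ x) = abv x) {x : F} (hx : nrm σ x = 1) : abv x = 1 := by
  have h : abv x * abv x = 1 := by
    have := congrArg abv hx
    rw [nrm, abv.map_mul, hσ, abv.map_one] at this
    exact this
  have h0 : 0 ≤ abv x := abv.nonneg x
  nlinarith [h, h0]

/-- the diagonal matrix of a norm-one tuple is integral. -/
theorem entryLE_diagonal (hσ : ∀ x, abv (σ x) = abv x) (a : Fin 2 → Fˣ) (ha : ∀ i, nrm σ ((a i : F)) = 1) :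
    EntryLE abv 1 (diagonal fun i => ((a i : Fˣ) : F)) := by
  intro i j
  by_cases hij : i = j
  · subst hij
    rw [diagonal_apply_eq, abv_eq_one_of_nrm abv σ hσ (ha i)]
  · rw [diagonal_apply_ne _ hij, abv.map_zero]
    exact zero_le_one

/-- **the first torus lies in `GL₂(𝓞)`** for an isometric involution. -/
theorem iotaA_mem_integralSubgroupAbv (hσ : ∀ x, abv (σ x) = abv x) (a : torusA σ) :
    iotaA σ a ∈ integralSubgroupAbv abv hna := by
  refine ⟨?_, ?_⟩
  · rw [coe_iotaA]
    exact entryLE_diagonal abv σ hσ _ (fun i => nrm_iotaA_entry σ a i)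
  · rw [← map_inv, coe_iotaA]
    exact entryLE_diagonal abv σ hσ _ (fun i => nrm_iotaA_entry σ a⁻¹ i)

end integral

/-! ## The unramified clauses on the concrete tori with Mathlib's Haar measures -/

section concrete

variable {F : Type*} [NormedField F] [ProperSpace F] [IsUltrametricDist F] (σ : F →+* F)

/-- **the three clauses of the unramified kind on the concrete model**: Borel σ-algebras and Haar measures on the
compact tori DISPLAYED as conjuncts (`BorelSpace`, `IsHaarMeasure` — the witnesses are Mathlib's Haar measures, not
«some measures making the clauses true»); the first torus integral by `iotaA_mem_integralSubgroupAbv`, the second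
by the displayed `hB / hB'`; the characters trivial; `loc γ₀` in the support displayed. The non-vanishing `b γ₀ ≠ 0`
is `μA(T_A) · μB(T_B) ≠ 0` from the Haar measures' `IsOpenPosMeasure` (`NeZero μ`) on the compact tori; the bound
clause with `C = 1`, `ε = 0` reads `‖b γ‖ ≤ ‖b γ₀‖` — a MONOTONICITY-OF-MEASURE statement: `b γ₀` is the full measure
`μA(T_A) · μB(T_B)` because `loc γ₀ ∈ K_w` (`hγ₀`), `T_A ⊂ K_w` (a theorem) and `T_B ⊂ K_w` (`hB / hB'`, LOAD-BEARING:
without it `b γ₀` would be the measure of `T_A × (T_B ∩ K_w)` only and `C = 1` would fail), while every `b γ` is the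
measure of a subset; the clause is independent of `size` (any `size` works at exponent `0`; crit-2 STATUS l. 16278
(B)(2)–(3)). -/
theorem unramified_placeClauses (hσc : Continuous σ) (hσn : ∀ x, ‖σ x‖ = ‖x‖) (f : Fin 2 → Fin 2 → F)
    (P : GL (Fin 2) F) (hP : ∀ j, (P : Matrix (Fin 2) (Fin 2) F).col j = f j)
    (hB : ∀ b : torusB σ f, EntryLE normAbv 1 ((iotaB σ f b : GL (Fin 2) F) : Matrix (Fin 2) (Fin 2) F))
    (hB' : ∀ b : torusB σ f, EntryLE normAbv 1 (((iotaB σ f b)⁻¹ : GL (Fin 2) F) : Matrix (Fin 2) (Fin 2) F))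
    {Orb : Type*} (loc : Orb → GL (Fin 2) F) (γ₀ : Orb)
    (hγ₀ : InSupport (iotaA σ) (iotaB σ f) 1 (integralSubgroupAbv normAbv isNonarchimedean_normAbv) (loc γ₀))
    (size : Orb → ℝ) :
    ∃ (mA : MeasurableSpace (torusA σ)) (mB : MeasurableSpace (torusB σ f))
      (μA : Measure (torusA σ)) (μB : Measure (torusB σ f)),
      (@BorelSpace (torusA σ) _ mA) ∧ (@BorelSpace (torusB σ f) _ mB) ∧
      μA.IsHaarMeasure ∧ μB.IsHaarMeasure ∧
      PlaceClauses (unramifiedFactor μA μB (iotaA σ) (iotaB σ f) 1 1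
          (integralSubgroupAbv normAbv isNonarchimedean_normAbv) loc)
        (fun γ => InSupport (iotaA σ) (iotaB σ f) 1 (integralSubgroupAbv normAbv isNonarchimedean_normAbv) (loc γ))
        1 0 size γ₀ := by
  haveI hcA : CompactSpace (torusA σ) := compactSpace_torusA σ hσc hσn
  haveI hcB : CompactSpace (torusB σ f) := compactSpace_torusB σ f P hσc hσn hP
  haveI hsA : SecondCountableTopology (torusA σ) := secondCountable_torusA σ
  haveI hsB : SecondCountableTopology (torusB σ f) := secondCountable_torusB σ f
  letI mA : MeasurableSpace (torusA σ) := borel _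
  haveI hbA : BorelSpace (torusA σ) := ⟨rfl⟩
  letI mB : MeasurableSpace (torusB σ f) := borel _
  haveI hbB : BorelSpace (torusB σ f) := ⟨rfl⟩
  let μA : Measure (torusA σ) := Measure.haar
  let μB : Measure (torusB σ f) := Measure.haar
  haveI : IsFiniteMeasure μA := CompactSpace.isFiniteMeasure
  haveI : IsFiniteMeasure μB := CompactSpace.isFiniteMeasure
  refine ⟨mA, mB, μA, μB, hbA, hbB, inferInstance, inferInstance, ?_⟩
  have hA : ∀ a, iotaA σ a ∈ integralSubgroupAbv normAbv isNonarchimedean_normAbv :=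
    fun a => iotaA_mem_integralSubgroupAbv normAbv isNonarchimedean_normAbv σ (fun x => hσn x) a
  have hB2 : ∀ b, iotaB σ f b ∈ integralSubgroupAbv normAbv isNonarchimedean_normAbv := fun b => ⟨hB b, hB' b⟩
  exact unramifiedFactor_clauses μA μB (iotaA σ) (iotaB σ f) 1 1 _ loc hA hB2 (fun _ => rfl) (fun _ => rfl)
    (NeZero.ne _) (NeZero.ne _) γ₀ hγ₀ size

end concrete

/-! ## At Mathlib's completion -/

section completion

variable {E : Type*} [Field E] [NumberField E] (w : HeightOneSpectrum (𝓞 E)) (σ : E →+* E)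
  (hσ : ∀ x, w.valuation E (σ x) = w.valuation E x)

/-- **the unramified clauses at `F := w.adicCompletion E`** with `σ := completionMap w σ hσ`: the instance binders
(`ProperSpace`, `IsUltrametricDist`) and `hσc / hσn` discharged (p703140 / p703979). -/
theorem unramified_placeClauses_adicCompletion
    (f : Fin 2 → Fin 2 → w.adicCompletion E) (P : GL (Fin 2) (w.adicCompletion E))
    (hP : ∀ j, (P : Matrix (Fin 2) (Fin 2) (w.adicCompletion E)).col j = f j)
    (hB : ∀ b : torusB (completionMap w σ hσ) f,
      EntryLE normAbv 1 ((iotaB (completionMap w σ hσ) f b : GL (Fin 2) (w.adicCompletion E)) :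
        Matrix (Fin 2) (Fin 2) (w.adicCompletion E)))
    (hB' : ∀ b : torusB (completionMap w σ hσ) f,
      EntryLE normAbv 1 (((iotaB (completionMap w σ hσ) f b)⁻¹ : GL (Fin 2) (w.adicCompletion E)) :
        Matrix (Fin 2) (Fin 2) (w.adicCompletion E)))
    {Orb : Type*} (loc : Orb → GL (Fin 2) (w.adicCompletion E)) (γ₀ : Orb)
    (hγ₀ : InSupport (iotaA (completionMap w σ hσ)) (iotaB (completionMap w σ hσ) f) 1
      (integralSubgroupAbv normAbv isNonarchimedean_normAbv) (loc γ₀))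
    (size : Orb → ℝ) :
    ∃ (mA : MeasurableSpace (torusA (completionMap w σ hσ)))
      (mB : MeasurableSpace (torusB (completionMap w σ hσ) f))
      (μA : Measure (torusA (completionMap w σ hσ))) (μB : Measure (torusB (completionMap w σ hσ) f)),
      (@BorelSpace (torusA (completionMap w σ hσ)) _ mA) ∧ (@BorelSpace (torusB (completionMap w σ hσ) f) _ mB) ∧
      μA.IsHaarMeasure ∧ μB.IsHaarMeasure ∧
      PlaceClauses (unramifiedFactor μA μB (iotaA (completionMap w σ hσ)) (iotaB (completionMap w σ hσ) f) 1 1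
          (integralSubgroupAbv normAbv isNonarchimedean_normAbv) loc)
        (fun γ => InSupport (iotaA (completionMap w σ hσ)) (iotaB (completionMap w σ hσ) f) 1
          (integralSubgroupAbv normAbv isNonarchimedean_normAbv) (loc γ))
        1 0 size γ₀ :=
  unramified_placeClauses (completionMap w σ hσ) (continuous_completionMap w σ hσ) (norm_completionMap w σ hσ) f P hP
    hB hB' loc γ₀ hγ₀ size

end completion

end Summit.Ventures.HodgeRepro2.Tier7.Line3.UnramifiedPlaceCompletion
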